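import Summits.RiemannHypothesis.RiemannHypothesis.Theorems.SuzukiPhiFredholmWindows
import Literature.NumberTheory.LFunctions.SuzukiConditionalWindowsProofs

/-!
# SuzukiPhiZetaKernels — Suzuki's `φ^±(t,·)` for the kernels `K_ζ^{ω,ν}` EXIST at every `t ≥ 0` when `ω ≥ ½`
# (column DBR; RH-FREE)

LINE 1 — LABEL: RH-FREE (unconditional: the half `ω ≥ ½` of [Su21] needs no hypothesis on the zeros of `ζ`); bears_on
LADDER-RH B-P(P3)/(P2) (the `(ω,ν)`-Hamiltonian family of route `DeBrangesSuzukiDoor`, stmt-RiemannHypothesis-19728;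
rh-columns-lit's «construction C2» `suzukiPhiPlus/Minus`).  WHAT THIS IS NOT: nothing is said for `ω < ½` (there the
windows are RH-EQUIVALENT); no positivity, nothing about zeros of `ζ`; nothing here bears on the truth of RH.

M. Suzuki, J. Funct. Anal. 281 (2021) 109116 [Su21]: for the kernels `K = K_ζ^{ω,ν}` (`suzukiKernel ω ν`, (2.6)) with
`ω ≥ ½`, `ν ≥ 1`, `νω > 1`, EVERY window is clean — `suzuki2021_windows_of_half_le'` (rh-crit-dbl, from Prop. 4.4:
`E ∈ HB̄` unconditionally since `ξ` has no zeros with `Re s > 1`), `K` is continuous (`suzuki2021_prop41_iv`) and vanishes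
on `(−∞,0)` (`suzuki2021_prop41_i`).  Hence Lemma 3.3 (`Theorems/SuzukiPhiFredholm`, Fredholm alternative) applies at
EVERY `t ≥ 0`:
* `exists_isSuzukiPhiSolution_suzukiKernel`, `isSuzukiPhiSolution_suzukiKernel_ae_unique` — (3.4) is uniquely solvable;
* `isSuzukiPhiSolution_suzukiPhiPlus` / `…Minus`, `continuous_suzukiPhiPlus` / `…Minus`, `eq_suzukiPhiPlus` / `eq_suzukiPhiMinus`
  — the tree's `suzukiPhiPlus ω ν t` / `suzukiPhiMinus ω ν t` (Literature/SuzukiPhiFunctions, defined by choice from SOME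
  solution) ARE the solutions `φ^±(t,·)`: continuous on `ℝ`, solving (3.4) at every `x ≤ t`, and every `L²(−∞,t)` solution
  coincides with them pointwise on `(−∞,t]` — i.e. the hypotheses `(h : ∃ X, IsSuzukiPhiSolution …)` and `huniq` of that
  file are DISCHARGED for `ω ≥ ½` at all `t ≥ 0`.

References: [Su21] §2 (2.6)–(2.9), §3.3 Lemma 3.3, Prop. 4.1, Prop. 4.4.
-/

noncomputable section

-- D-0017: `Summit.<S>.<S>.…` is the designed namespace of a single-problem summit.
set_option linter.dupNamespace false

open MeasureTheory Set Filter Topology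

namespace Summit.RiemannHypothesis.RiemannHypothesis.Theorems.SuzukiPhiExistence

open Literature.NumberTheory.LFunctions

variable {ω t ε : ℝ} {ν : ℕ}

/-- RH-FREE.  `K_ζ^{ω,ν}` vanishes on `(−∞,0]` (`ω > 0`, `ν ≥ 1`, `νω > 1`): [Su21] Prop. 4.1 (1) on `(−∞,0)`, and
`K(0) = 0` by continuity (Prop. 4.1 (4)). -/
theorem suzukiKernel_eq_zero_of_nonpos (hω : 0 < ω) (hν : 1 ≤ ν) (hνω : 1 < (ν : ℝ) * ω) {x : ℝ} (hx : x ≤ 0) :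
    suzukiKernel ω ν x = 0 := by
  rcases hx.lt_or_eq with hlt | heq
  · exact (suzuki2021_prop41_i hω hν hνω hlt).1
  · subst heq
    have hc := (suzuki2021_prop41_iv hω ν hνω).continuousAt (x := 0)
    have hlim : Tendsto (suzukiKernel ω ν) (𝓝[<] (0 : ℝ)) (𝓝 0) := by
      apply tendsto_const_nhds.congr'
      filter_upwards [self_mem_nhdsWithin] with y hy
      exact ((suzuki2021_prop41_i hω hν hνω hy).1).symm
    exact tendsto_nhds_unique (hc.tendsto.mono_left nhdsWithin_le_nhds) hlim

/-- **RH-FREE · Suzuki's (3.4) for `K_ζ^{ω,ν}` is solvable at EVERY `t ≥ 0` when `ω ≥ ½`** (`ν ≥ 1`, `νω > 1`,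
`ε = ±1`): every window is clean (`suzuki2021_windows_of_half_le'`) and Lemma 3.3 applies. -/
theorem exists_isSuzukiPhiSolution_suzukiKernel (hω : 1 / 2 ≤ ω) (hν : 1 ≤ ν) (hνω : 1 < (ν : ℝ) * ω) (ht : 0 ≤ t)
    (hε : ε = 1 ∨ ε = -1) : ∃ X : ℝ → ℝ, IsSuzukiPhiSolution (suzukiKernel ω ν) ε t X :=
  exists_isSuzukiPhiSolution_of_noUnitEigenvalue (suzuki2021_prop41_iv (by linarith) ν hνω)
    (fun _ hu ↦ suzukiKernel_eq_zero_of_nonpos (by linarith) hν hνω hu) hε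
    (suzuki2021_windows_of_half_le' hω hν hνω ht)

/-- RH-FREE.  … and the solution is a.e. unique on `(−∞,t]`. -/
theorem isSuzukiPhiSolution_suzukiKernel_ae_unique (hω : 1 / 2 ≤ ω) (hν : 1 ≤ ν) (hνω : 1 < (ν : ℝ) * ω)
    (ht : 0 ≤ t) (hε : ε = 1 ∨ ε = -1) {X Y : ℝ → ℝ} (hX : IsSuzukiPhiSolution (suzukiKernel ω ν) ε t X)
    (hY : IsSuzukiPhiSolution (suzukiKernel ω ν) ε t Y) : X =ᵐ[volume.restrict (Iic t)] Y :=
  isSuzukiPhiSolution_ae_unique_of_noUnitEigenvalue (suzuki2021_prop41_iv (by linarith) ν hνω)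
    (fun _ hu ↦ suzukiKernel_eq_zero_of_nonpos (by linarith) hν hνω hu) ht hε
    (suzuki2021_windows_of_half_le' hω hν hνω ht) hX hY

/-- **RH-FREE · `suzukiPhiPlus ω ν t` IS `φ^+(t,·)`**: for `ω ≥ ½`, `ν ≥ 1`, `νω > 1`, `t ≥ 0`, the tree's `φ^+`
solves (3.4) with `ε = +1` at every `x ≤ t`. -/
theorem isSuzukiPhiSolution_suzukiPhiPlus (hω : 1 / 2 ≤ ω) (hν : 1 ≤ ν) (hνω : 1 < (ν : ℝ) * ω) (ht : 0 ≤ t) :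
    IsSuzukiPhiSolution (suzukiKernel ω ν) 1 t (suzukiPhiPlus ω ν t) := by
  rw [suzukiPhiPlus_def]
  exact isSuzukiPhiSolution_suzukiPhiExt (exists_isSuzukiPhiSolution_suzukiKernel hω hν hνω ht (Or.inl rfl))

/-- **RH-FREE · `suzukiPhiMinus ω ν t` IS `φ^−(t,·)`** (`ε = −1`). -/
theorem isSuzukiPhiSolution_suzukiPhiMinus (hω : 1 / 2 ≤ ω) (hν : 1 ≤ ν) (hνω : 1 < (ν : ℝ) * ω) (ht : 0 ≤ t) :
    IsSuzukiPhiSolution (suzukiKernel ω ν) (-1) t (suzukiPhiMinus ω ν t) := by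
  rw [suzukiPhiMinus_def]
  exact isSuzukiPhiSolution_suzukiPhiExt (exists_isSuzukiPhiSolution_suzukiKernel hω hν hνω ht (Or.inr rfl))

/-- RH-FREE.  `φ^+(t,·)` is continuous on `ℝ` (`ω > 0`, `ν ≥ 1`, `νω > 1`; any real `t`). -/
theorem continuous_suzukiPhiPlus (hω : 0 < ω) (hν : 1 ≤ ν) (hνω : 1 < (ν : ℝ) * ω) (t : ℝ) :
    Continuous (suzukiPhiPlus ω ν t) := by
  rw [suzukiPhiPlus_def]
  exact continuous_suzukiPhiExt (suzuki2021_prop41_iv hω ν hνω) (fun u hu ↦ (suzuki2021_prop41_i hω hν hνω hu).1) 1 t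

/-- RH-FREE.  `φ^−(t,·)` is continuous on `ℝ` (`ω > 0`, `ν ≥ 1`, `νω > 1`; any real `t`). -/
theorem continuous_suzukiPhiMinus (hω : 0 < ω) (hν : 1 ≤ ν) (hνω : 1 < (ν : ℝ) * ω) (t : ℝ) :
    Continuous (suzukiPhiMinus ω ν t) := by
  rw [suzukiPhiMinus_def]
  exact continuous_suzukiPhiExt (suzuki2021_prop41_iv hω ν hνω) (fun u hu ↦ (suzuki2021_prop41_i hω hν hνω hu).1)
    (-1) t

/-- **RH-FREE · CHOICE-FREENESS of `φ^+`**: every `L²(−∞,t)` solution of (3.4) (`ε = +1`) equals `suzukiPhiPlus ω ν t`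
at every `x ≤ t` (`ω ≥ ½`, `ν ≥ 1`, `νω > 1`, `t ≥ 0`). -/
theorem eq_suzukiPhiPlus (hω : 1 / 2 ≤ ω) (hν : 1 ≤ ν) (hνω : 1 < (ν : ℝ) * ω) (ht : 0 ≤ t) {X : ℝ → ℝ}
    (hX : IsSuzukiPhiSolution (suzukiKernel ω ν) 1 t X) {x : ℝ} (hx : x ≤ t) : X x = suzukiPhiPlus ω ν t x := by
  rw [suzukiPhiPlus_def]
  exact eq_suzukiPhiExt_of_noUnitEigenvalue (suzuki2021_prop41_iv (by linarith) ν hνω)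
    (fun _ hu ↦ suzukiKernel_eq_zero_of_nonpos (by linarith) hν hνω hu) ht (Or.inl rfl)
    (suzuki2021_windows_of_half_le' hω hν hνω ht) hX hx

/-- **RH-FREE · CHOICE-FREENESS of `φ^−`** (`ε = −1`). -/
theorem eq_suzukiPhiMinus (hω : 1 / 2 ≤ ω) (hν : 1 ≤ ν) (hνω : 1 < (ν : ℝ) * ω) (ht : 0 ≤ t) {X : ℝ → ℝ}
    (hX : IsSuzukiPhiSolution (suzukiKernel ω ν) (-1) t X) {x : ℝ} (hx : x ≤ t) : X x = suzukiPhiMinus ω ν t x := by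
  rw [suzukiPhiMinus_def]
  exact eq_suzukiPhiExt_of_noUnitEigenvalue (suzuki2021_prop41_iv (by linarith) ν hνω)
    (fun _ hu ↦ suzukiKernel_eq_zero_of_nonpos (by linarith) hν hνω hu) ht (Or.inr rfl)
    (suzuki2021_windows_of_half_le' hω hν hνω ht) hX hx

/-- RH-FREE.  `φ^±(t,·)` vanish on `(−∞,−t)` (`ω > 0`, `ν ≥ 1`, `νω > 1`). -/
theorem suzukiPhiPlus_eq_zero_of_lt_neg (hω : 0 < ω) (hν : 1 ≤ ν) (hνω : 1 < (ν : ℝ) * ω) {x : ℝ} (hx : x < -t) :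
    suzukiPhiPlus ω ν t x = 0 ∧ suzukiPhiMinus ω ν t x = 0 := by
  rw [suzukiPhiPlus_def, suzukiPhiMinus_def]
  exact ⟨suzukiPhiExt_eq_zero_of_lt_neg (fun u hu ↦ (suzuki2021_prop41_i hω hν hνω hu).1) hx,
    suzukiPhiExt_eq_zero_of_lt_neg (fun u hu ↦ (suzuki2021_prop41_i hω hν hνω hu).1) hx⟩

end Summit.RiemannHypothesis.RiemannHypothesis.Theorems.SuzukiPhiExistence

end
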